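import Summits.HodgeConjecture.CorCM.B01.Transposition.HComp.RecordSystemConjFrame
import Summits.HodgeConjecture.CorCM.B01.Transposition.HComp.RecordSystemConjPieces
import Literature.AlgebraicGeometry.Motives.BaseChangeAlgebraicExtension
import HarnessLib

/-!
# Off-place half of `HLiu418`, bridge B2 «same models, conjugate embedding» — BASE (the frame and the model twist)

Cell `hodgecm-mathlib`, seat A-p06 (director g1 2026-08-28T03:38:44Z: resolution of record for the off-place residual of `HLiu418` =
row I-4 `canonicalModel_unique_printed` + B1 ✔ `RecordSystemConj.exists_conj` + B2 + B3; A-p06 = B2).  B2 re-reads a Deligne record of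
the unitary datum `(H, τ, T)` ([Deligne1979ShimuraVarieties] 2.2.4–2.2.5, typed `UnitaryCanonicalModel.RecordSystem L H τ T hT K₀`) at the
CONJUGATE embedding `(H, τ̄ := conj ∘ τ, T̄ := conjFrame T)` with the SAME model functor `M`.  This file holds the two hypothesis-free
pieces every variant of B2 starts from:

* `formCongr_conjFrame_starRingEnd_comp` — the frame index at `τ̄`: `T̄ᴴ H^{τ̄} T̄ = J` (since `H^{τ̄} = (c H)^{τ}`, ✔ `formCongr_conjFrame`);
* `modelsAlongConjIso M : M ⋙ (·)_{τ̄} ≅ (M ⋙ (·)_τ) ⋙ (·)^{conj}` — the SAME `L`-models read along `τ̄` are, functorially in the level,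
  the complex-conjugate twists of the models read along `τ` (transitivity of base change, [GortzWedhorn2020] Prop. 4.16, natural in the
  family: ✔ `baseChangeHomObjIsoOfComp(_comm)`).

The remaining B2 pieces (the complex record system along `τ̄` with points `[x, a] ↦ [x̄, a]`, and (62) for `Aut(ℂ/τ̄L)` through the twist,
then ✔ `recordSystem_exists_of_descent`) are specified in the seat's HOME note `A-provers/A-p06/B2-DESIGN-alongConj.md`.  Theorems and one
definition by explicit formula (a natural isomorphism); no named fact, no instance, no `sorry`.  HC_CM is NOT proved here; HC_CM is proved
only modulo the 7 printed citations until rung 0 closes.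
-/

set_option autoImplicit false

noncomputable section

open CategoryTheory AlgebraicGeometry NumberField Matrix
open Literature.AlgebraicGeometry.Motives
open Literature.NumberTheory.Automorphic.Liu2021.AppendixC (C5.OpenCompactSubgroup C5.SmallLevel)
open Literature.AlgebraicGeometry.ShimuraVarieties Literature.AlgebraicGeometry.ShimuraVarieties.UnitaryCanonicalModel
open Literature.NumberTheory.Automorphic Literature.NumberTheory.Automorphic.UnitaryGroup
open Literature.Geometry.ComplexHyperbolic Literature.Geometry.ComplexHyperbolic.BallModel

namespace Summit.HodgeConjecture.CorCM.Model.RecordSystemConj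

variable {L : Type} [Field L]

/-- **The frame index at the conjugate embedding**: if `Tᴴ H^{τ} T = J` then `T̄ᴴ H^{τ̄} T̄ = J` for `τ̄ = conj ∘ τ`, `T̄ = conjFrame T` —
because `H^{τ̄} = conj ∘ H^{τ} = (c H)^{τ}` entrywise (✔ `map_map_starRingEnd_eq_conjGram_map`) and ✔ `formCongr_conjFrame`.
[cite: Milne2005ShimuraVarieties, §12 (the datum (G, X̄)); Def. 12.8 p. 114] -/
theorem formCongr_conjFrame_starRingEnd_comp [NumberField L] [IsCMField L] (H : Matrix (Fin 3) (Fin 3) L) (τ : L →+* ℂ) (T : GL (Fin 3) ℂ)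
    (hT : formCongr (starRingEnd ℂ) T (H.map τ) = BallModel.J) :
    formCongr (starRingEnd ℂ) (conjFrame T) (H.map ((starRingEnd ℂ).comp τ)) = BallModel.J := by
  rw [RingHom.coe_comp, ← Matrix.map_map, map_map_starRingEnd_eq_conjGram_map]
  exact formCongr_conjFrame L H τ T hT

/-- **The same `L`-models read along `τ̄ = conj ∘ τ` are the conjugate twists of the models read along `τ`**, functorially in the level:
`M ⋙ (·)_{τ̄} ≅ (M ⋙ (·)_τ) ⋙ (·)^{conj}` — transitivity of base change `(X ⊗_{L,τ} ℂ) ⊗_{ℂ,conj} ℂ ≅ X ⊗_{L,conj∘τ} ℂ`, natural in `X`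
(the components are ✔ `baseChangeHomObjIsoOfComp τ conj (conj ∘ τ) rfl`, naturality ✔ `baseChangeHomObjIsoOfComp_comm`; the component
family is NOT η-expanded so that the kernel re-check of `NatIso.ofComponents` stays syntactic).
[cite: GortzWedhorn2020, Prop. 4.16 and §(4.7)] -/
def modelsAlongConjIso {ι : Type} [Category ι] (M : ι ⥤ SchemeOver L) (τ : L →+* ℂ) :
    (M ⋙ baseChangeHom ((starRingEnd ℂ).comp τ)) ≅ (M ⋙ baseChangeHom τ) ⋙ baseChangeHom (starRingEnd ℂ) :=
  (NatIso.ofComponents (fun X => baseChangeHomObjIsoOfComp τ (starRingEnd ℂ) ((starRingEnd ℂ).comp τ) rfl (M.obj X))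
    (fun f => by rw [Functor.comp_map]; exact baseChangeHomObjIsoOfComp_comm τ (starRingEnd ℂ) _ rfl (M.map f))).symm

/-- The components of `modelsAlongConjIso`, on the nose: `(modelsAlongConjIso M τ).inv.app K = (baseChangeHomObjIsoOfComp τ conj τ̄ rfl (M K)).hom`
(so consumers rewrite with the ✔ projection formulas `baseChangeHomObjIsoOfComp_hom_left_fst` etc. instead of unfolding `NatIso.ofComponents`).
[cite: GortzWedhorn2020, Prop. 4.16 and §(4.7)] -/
theorem modelsAlongConjIso_inv_app {ι : Type} [Category ι] (M : ι ⥤ SchemeOver L) (τ : L →+* ℂ) (K : ι) :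
    (modelsAlongConjIso M τ).inv.app K =
      (baseChangeHomObjIsoOfComp τ (starRingEnd ℂ) ((starRingEnd ℂ).comp τ) rfl (M.obj K)).hom :=
  rfl

/-- … and `(modelsAlongConjIso M τ).hom.app K = (baseChangeHomObjIsoOfComp τ conj τ̄ rfl (M K)).inv`. [cite: GortzWedhorn2020, Prop. 4.16 and §(4.7)] -/
theorem modelsAlongConjIso_hom_app {ι : Type} [Category ι] (M : ι ⥤ SchemeOver L) (τ : L →+* ℂ) (K : ι) :
    (modelsAlongConjIso M τ).hom.app K =
      (baseChangeHomObjIsoOfComp τ (starRingEnd ℂ) ((starRingEnd ℂ).comp τ) rfl (M.obj K)).inv :=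
  rfl

end Summit.HodgeConjecture.CorCM.Model.RecordSystemConj

end
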